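import Literature.NumberTheory.Sieve.CFCongruenceTransferOperator
import Literature.NumberTheory.Sieve.CFSemigroupTwistedResolvent
import HarnessLib

/-!
# Bridge between MOW's `𝓛_{s,q}` on functions `I → ℂ^{Γ_q}` and the tree's `cfTwist` on `Γ_q → CfLip`

Support file (all results proved) for the reduction of the named fact
`Literature.NumberTheory.Sieve.MageeOhWinter2019_uniformCounting` to [MageeOhWinter2019, Thm. 4].
The tree's renewal machinery uses the twisted operator `𝓜_s = cfTwist A hA q s` on the Banach space
`SL₂(ℤ/qℤ) → CfLip` of `Γ_q`-indexed families of Lipschitz functions on `[0,1]`; MOW's Theorem 4 is about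
the same operator `𝓛_{s,q} = cfCongL A q s` acting on `ℂ^{Γ_q}`-valued functions on `I ⊊ [0,1]`.

* `cfVecOf Φ x = (Φ_η(x))_η ∈ ℂ^{Γ_q}`: the vector form of a family; `cfVecOf_cfTwist`: **on `[0,1]`,
  `vec(𝓜_s Φ) = 𝓛_{s,q} vec(Φ)`** — the two operators agree.
* weights: `‖denom^{-2s}‖ ≤ 1` and `x ↦ denom(g_a g_{a'},x)^{-2s}` is `2‖s‖`-Lipschitz on `x ≥ 0`
  (`norm_cfWt_pair_sub_le`, by the mean value theorem — linear in `‖s‖`, no exponential loss);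
* `cfCongL_lipStep`: one-step sup/Lipschitz estimate for `𝓛_{s,q} h`;
* `CfLip.ofFun`, `cfExt2`: the **two-step extension** `g ↦ (η ↦ (𝓛²_{s,q} g)_η|_{[0,1]})` of a piecewise
  Lipschitz `g` on `I` to a family in `SL₂(ℤ/qℤ) → CfLip` (two steps of the dynamics bring `[0,1]` into
  `I`: `g_{a} g_{a'} [0,1] ⊆ I_A` and `g_b g_{b'} I_A = I_{b,b'} ⊆ I`), with norm bounds;
* `cfTwist_bijective_of_inverseData`, `isUnit_one_sub_cfTwist_of_bounds`,
  `isUnit_one_sub_cfTwB_of_bounds`: **if the Neumann-type series `Σ_m 𝓛^m_{s,q}` is controlled on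
  piecewise Lipschitz functions on `I` (summable operator bounds), then `1 - 𝓜_s` (resp. `1 - B_s` for the
  part orthogonal to constants) is a unit of `End(SL₂(ℤ/qℤ) → CfLip)`, with an explicit formula and a
  sup-norm bound for the inverse.**

## References

* [MageeOhWinter2019] M. Magee, H. Oh, D. Winter, J. reine angew. Math. 753 (2019) 89–135, §3.2, Thm. 4.
-/

noncomputable section

open Set Filter
open scoped MatrixGroups Topology

namespace Literature.NumberTheory.Sieve

variable {A : Finset ℕ}

/-! ### The vector form of a family and the identification `𝓜_s = 𝓛_{s,q}` -/

section VecOf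

variable {q : ℕ} [NeZero q]

/-- The vector form `x ↦ (Φ_η(x))_η ∈ ℂ^{Γ_q}` of a family `Φ : Γ_q → CfLip` (each `Φ_η` extended to `ℝ`
by the constant extension). [cite: MageeOhWinter2019, §3.2] -/
def cfVecOf (Φ : SL(2, ZMod q) → CfLip) (x : ℝ) : CfVec q := WithLp.toLp 2 fun η => (Φ η).extend x

/-- Coordinates of the vector form. [folklore] -/
@[simp] theorem cfVecOf_apply (Φ : SL(2, ZMod q) → CfLip) (x : ℝ) (η : SL(2, ZMod q)) :
    cfVecOf Φ x η = (Φ η).extend x := rfl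

/-- The vector form is additive in the family. [folklore] -/
theorem cfVecOf_add (Φ Ψ : SL(2, ZMod q) → CfLip) (x : ℝ) : cfVecOf (Φ + Ψ) x = cfVecOf Φ x + cfVecOf Ψ x := by
  ext η; simp [CfLip.extend_add]

/-- The vector form is subtractive in the family. [folklore] -/
theorem cfVecOf_sub (Φ Ψ : SL(2, ZMod q) → CfLip) (x : ℝ) : cfVecOf (Φ - Ψ) x = cfVecOf Φ x - cfVecOf Ψ x := by
  ext η
  simp only [cfVecOf_apply, Pi.sub_apply, PiLp.sub_apply]
  rw [sub_eq_add_neg, CfLip.extend_add, CfLip.neg_eq_smul, CfLip.extend_smul]; ring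

/-- The vector form of the zero family. [folklore] -/
@[simp] theorem cfVecOf_zero (x : ℝ) : cfVecOf (0 : SL(2, ZMod q) → CfLip) x = 0 := by
  ext η; rfl

/-- Coordinates of the vector form are bounded by the family's norm. [folklore] -/
theorem norm_cfVecOf_apply_le (Φ : SL(2, ZMod q) → CfLip) (x : ℝ) (η : SL(2, ZMod q)) : ‖cfVecOf Φ x η‖ ≤ ‖Φ‖ :=
  ((Φ η).norm_extend_le x).trans (norm_le_pi_norm Φ η)

/-- **Sup bound for the vector form:** `‖vec Φ (x)‖ ≤ √|Γ_q| · max_η sup|Φ_η|`. [folklore] -/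
theorem norm_cfVecOf_le (Φ : SL(2, ZMod q) → CfLip) {C : ℝ} (hC : 0 ≤ C) (h : ∀ η (y : Icc (0 : ℝ) 1), ‖Φ η y‖ ≤ C)
    (x : ℝ) : ‖cfVecOf Φ x‖ ≤ Real.sqrt (Fintype.card (SL(2, ZMod q))) * C :=
  norm_cfVec_le_of_forall_le _ hC fun η => h η _

/-- **Lipschitz bound for the vector form** on `[0,1]`: `‖vec Φ x - vec Φ y‖ ≤ √|Γ_q| · L |x - y|` if every
`Φ_η` is `L`-Lipschitz. [folklore] -/
theorem norm_cfVecOf_sub_le (Φ : SL(2, ZMod q) → CfLip) {L : ℝ} (hL : 0 ≤ L)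
    (h : ∀ η (x y : Icc (0 : ℝ) 1), ‖Φ η x - Φ η y‖ ≤ L * |(x : ℝ) - y|) {x y : ℝ} (hx : x ∈ Icc (0 : ℝ) 1)
    (hy : y ∈ Icc (0 : ℝ) 1) : ‖cfVecOf Φ x - cfVecOf Φ y‖ ≤ Real.sqrt (Fintype.card (SL(2, ZMod q))) * (L * |x - y|) := by
  have e : cfVecOf Φ x - cfVecOf Φ y = WithLp.toLp 2 fun η => (Φ η).extend x - (Φ η).extend y := by ext η; rfl
  rw [e]
  refine norm_cfVec_le_of_forall_le _ (by positivity) fun η => ?_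
  show ‖(Φ η).extend x - (Φ η).extend y‖ ≤ L * |x - y|
  rw [CfLip.extend_of_mem _ hx, CfLip.extend_of_mem _ hy]
  exact h η ⟨x, hx⟩ ⟨y, hy⟩

/-- A family is determined by its vector form on `[0,1]`. [folklore] -/
theorem eq_of_cfVecOf_eq {Φ Ψ : SL(2, ZMod q) → CfLip} (h : ∀ x ∈ Icc (0 : ℝ) 1, cfVecOf Φ x = cfVecOf Ψ x) : Φ = Ψ := by
  funext η
  refine CfLip.ext fun x => ?_
  have := congrArg (fun v : CfVec q => v η) (h x x.2)
  simpa only [cfVecOf_apply, CfLip.extend_coe] using this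

/-- The sum of the coordinates of the vector form is the (extended) sum of the family. [folklore] -/
theorem sum_cfVecOf_apply (Φ : SL(2, ZMod q) → CfLip) (x : ℝ) : ∑ η, cfVecOf Φ x η = (∑ η, Φ η).extend x := by
  simp only [cfVecOf_apply, CfLip.extend, CfLip.finset_sum_apply]

variable (A) (hA : ∀ a ∈ A, 1 ≤ a) (q)

include hA in
/-- **The tree's twisted operator is MOW's congruence transfer operator:** for `x ∈ [0,1]`,
`vec(𝓜_s Φ)(x) = 𝓛_{s,q}[vec Φ](x)`. [cite: MageeOhWinter2019, §3.2 eq. (3.4)] -/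
theorem cfVecOf_cfTwist (s : ℂ) (Φ : SL(2, ZMod q) → CfLip) {x : ℝ} (hx : x ∈ Icc (0 : ℝ) 1) :
    cfVecOf (cfTwist A hA q s Φ) x = cfCongL A q s (cfVecOf Φ) x := by
  ext η
  rw [cfCongL_apply_coord, cfVecOf_apply, CfLip.extend_of_mem _ hx, cfTwist_apply, CfLip.finset_sum_apply]
  simp_rw [CfLip.finset_sum_apply, cfPairOp_apply, cfSigma]
  rw [← Finset.sum_attach A]
  refine Finset.sum_congr rfl fun a _ => ?_
  rw [← Finset.sum_attach A]
  refine Finset.sum_congr rfl fun b _ => ?_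
  rfl

end VecOf

/-! ### The weights: size and Lipschitz constant (linear in `‖s‖`) -/

section Weights

/-- `‖denom(g_a g_{a'}, x)^{-2s}‖ ≤ 1` for `Re s ≥ 0`, `x ≥ 0`. [folklore] -/
theorem norm_cfWt_pair_le_one {s : ℂ} (hs : 0 ≤ s.re) (a a' : ℕ) {x : ℝ} (hx : 0 ≤ x) :
    ‖cfWt s (cfGen a * cfGen a') x‖ ≤ 1 := by
  have hd := one_le_cfDenom_pair a a' hx
  rw [norm_cfWt s _ (lt_of_lt_of_le one_pos hd)]
  exact Real.rpow_le_one_of_one_le_of_nonpos (by nlinarith) (by linarith)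

/-- **Derivative of the weight in the real variable:** `(denom^{-2s})' = denom^{-2s} · (-2s · M₁₀/denom)`.
[folklore] -/
theorem hasDerivAt_cfWt_real (s : ℂ) (M : Matrix (Fin 2) (Fin 2) ℤ) {x : ℝ} (hx : 0 < cfDenom M x) :
    HasDerivAt (fun y => cfWt s M y) (cfWt s M x * (-(2 * s * (((M 1 0 : ℝ) / cfDenom M x : ℝ) : ℂ)))) x := by
  unfold cfWt
  have hden : HasDerivAt (fun y : ℝ => cfDenom M y) (M 1 0 : ℝ) x := by
    unfold cfDenom
    simpa using ((hasDerivAt_id x).const_mul (M 1 0 : ℝ)).add_const (M 1 1 : ℝ)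
  have hlog : HasDerivAt (fun y : ℝ => Real.log (cfDenom M y)) ((M 1 0 : ℝ) / cfDenom M x) x := by
    simpa using hden.log hx.ne'
  have hof : HasDerivAt (fun y : ℝ => ((Real.log (cfDenom M y) : ℝ) : ℂ)) ((((M 1 0 : ℝ) / cfDenom M x : ℝ) : ℂ)) x :=
    hlog.ofReal_comp
  have harg : HasDerivAt (fun y : ℝ => -(2 * s * ((Real.log (cfDenom M y) : ℝ) : ℂ)))
      (-(2 * s * (((M 1 0 : ℝ) / cfDenom M x : ℝ) : ℂ))) x := (hof.const_mul (2 * s)).neg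
  exact harg.cexp

/-- **The weight is `2‖s‖`-Lipschitz on `x ≥ 0`** (`Re s ≥ 0`, `a' ≥ 1`): by the mean value theorem,
since `|denom'/denom| ≤ 1` and `‖denom^{-2s}‖ ≤ 1`. [cite: MageeOhWinter2019, Lemma 23] -/
theorem norm_cfWt_pair_sub_le {s : ℂ} (hs : 0 ≤ s.re) {a a' : ℕ} (ha' : 1 ≤ a') {x y : ℝ} (hx : 0 ≤ x) (hy : 0 ≤ y) :
    ‖cfWt s (cfGen a * cfGen a') x - cfWt s (cfGen a * cfGen a') y‖ ≤ 2 * ‖s‖ * |x - y| := by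
  set M := cfGen a * cfGen a' with hM
  have hbound : ∀ z ∈ Ici (0 : ℝ), ‖cfWt s M z * (-(2 * s * (((M 1 0 : ℝ) / cfDenom M z : ℝ) : ℂ)))‖ ≤ 2 * ‖s‖ := by
    intro z hz
    have hz0 : (0 : ℝ) ≤ z := hz
    have hd := one_le_cfDenom_pair a a' hz0
    have hratio : |(M 1 0 : ℝ) / cfDenom M z| ≤ 1 := by
      have h10 : (M 1 0 : ℝ) = a := by rw [hM, cfGen_mul_cfGen]; simp
      have ha'1 : (1 : ℝ) ≤ a' := by exact_mod_cast ha'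
      have ha0 : (0 : ℝ) ≤ a := Nat.cast_nonneg a
      have hpos : (0 : ℝ) < a * (z + a') + 1 := by nlinarith
      rw [h10, hM, cfDenom_pair, abs_div, abs_of_nonneg ha0, abs_of_pos hpos, div_le_one hpos]
      nlinarith
    rw [norm_mul, norm_neg, norm_mul, norm_mul, Complex.norm_real, Real.norm_eq_abs, Complex.norm_two]
    have h1 := norm_cfWt_pair_le_one hs a a' hz0
    rw [← hM] at h1
    calc ‖cfWt s M z‖ * (2 * ‖s‖ * |(M 1 0 : ℝ) / cfDenom M z|) ≤ 1 * (2 * ‖s‖ * 1) := by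
          gcongr
      _ = 2 * ‖s‖ := by ring
  have hderiv : ∀ z ∈ Ici (0 : ℝ), HasDerivWithinAt (fun y => cfWt s M y)
      (cfWt s M z * (-(2 * s * (((M 1 0 : ℝ) / cfDenom M z : ℝ) : ℂ)))) (Ici 0) z := fun z hz =>
    (hasDerivAt_cfWt_real s M (lt_of_lt_of_le one_pos (one_le_cfDenom_pair a a' (show (0:ℝ) ≤ z from hz)))).hasDerivWithinAt
  have h := (convex_Ici (0 : ℝ)).norm_image_sub_le_of_norm_hasDerivWithin_le hderiv hbound hy hx
  rwa [Real.norm_eq_abs] at h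

end Weights

/-! ### One step of `𝓛_{s,q}`: sup and Lipschitz estimates -/

section LipStep

variable (A) {q : ℕ} [NeZero q]

/-- **One-step estimate.** If along every branch `x ↦ h(g_a g_{a'} x)` is bounded by `M_h` and
`L_h`-Lipschitz on a set `S ⊆ [0, ∞)`, then on `S`: `‖𝓛_{s,q} h‖ ≤ #A² M_h` and `𝓛_{s,q} h` is
`#A² (2‖s‖ M_h + L_h)`-Lipschitz (`Re s ≥ 0`). [cite: MageeOhWinter2019, Lemma 23] -/
theorem cfCongL_lipStep (hA : ∀ a ∈ A, 1 ≤ a) {s : ℂ} (hs : 0 ≤ s.re) {h : ℝ → CfVec q} {S : Set ℝ}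
    (hS : S ⊆ Ici 0) {Mh Lh : ℝ}
    (hb : ∀ a ∈ A, ∀ a' ∈ A, ∀ x ∈ S, ‖h (cfMoeb (cfGen a * cfGen a') x)‖ ≤ Mh)
    (hl : ∀ a ∈ A, ∀ a' ∈ A, ∀ x ∈ S, ∀ y ∈ S,
      ‖h (cfMoeb (cfGen a * cfGen a') x) - h (cfMoeb (cfGen a * cfGen a') y)‖ ≤ Lh * |x - y|) :
    (∀ x ∈ S, ‖cfCongL A q s h x‖ ≤ (A.card : ℝ) ^ 2 * Mh) ∧
    (∀ x ∈ S, ∀ y ∈ S, ‖cfCongL A q s h x - cfCongL A q s h y‖ ≤ (A.card : ℝ) ^ 2 * (2 * ‖s‖ * Mh + Lh) * |x - y|) := by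
  constructor
  · intro x hx
    have hx0 : (0 : ℝ) ≤ x := hS hx
    unfold cfCongL
    calc ‖∑ a ∈ A, ∑ a' ∈ A, cfWt s (cfGen a * cfGen a') x • cfRep (cfRed q (cfPair a a')) (h (cfMoeb (cfGen a * cfGen a') x))‖
        ≤ ∑ a ∈ A, ∑ a' ∈ A, Mh := by
          refine (norm_sum_le _ _).trans (Finset.sum_le_sum fun a ha => (norm_sum_le _ _).trans
            (Finset.sum_le_sum fun a' ha' => ?_))
          rw [norm_smul, norm_cfRep]
          calc ‖cfWt s (cfGen a * cfGen a') x‖ * ‖h (cfMoeb (cfGen a * cfGen a') x)‖ ≤ 1 * Mh :=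
                mul_le_mul (norm_cfWt_pair_le_one hs a a' hx0) (hb a ha a' ha' x hx) (norm_nonneg _) zero_le_one
            _ = Mh := one_mul _
      _ = (A.card : ℝ) ^ 2 * Mh := by simp [Finset.sum_const, nsmul_eq_mul]; ring
  · intro x hx y hy
    have hx0 : (0 : ℝ) ≤ x := hS hx
    have hy0 : (0 : ℝ) ≤ y := hS hy
    unfold cfCongL
    rw [← Finset.sum_sub_distrib]
    simp_rw [← Finset.sum_sub_distrib]
    calc ‖∑ a ∈ A, ∑ a' ∈ A, (cfWt s (cfGen a * cfGen a') x • cfRep (cfRed q (cfPair a a')) (h (cfMoeb (cfGen a * cfGen a') x)) -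
            cfWt s (cfGen a * cfGen a') y • cfRep (cfRed q (cfPair a a')) (h (cfMoeb (cfGen a * cfGen a') y)))‖
        ≤ ∑ a ∈ A, ∑ a' ∈ A, (2 * ‖s‖ * Mh + Lh) * |x - y| := by
          refine (norm_sum_le _ _).trans (Finset.sum_le_sum fun a ha => (norm_sum_le _ _).trans
            (Finset.sum_le_sum fun a' ha' => ?_))
          set w := fun z => cfWt s (cfGen a * cfGen a') z with hw
          set g := cfRed q (cfPair a a') with hg
          set u := h (cfMoeb (cfGen a * cfGen a') x) with hu
          set v := h (cfMoeb (cfGen a * cfGen a') y) with hv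
          have e : w x • cfRep g u - w y • cfRep g v = (w x - w y) • cfRep g u + w y • cfRep g (u - v) := by
            rw [cfRep_sub, sub_smul, smul_sub]; abel
          rw [e]
          calc ‖(w x - w y) • cfRep g u + w y • cfRep g (u - v)‖
              ≤ ‖w x - w y‖ * ‖u‖ + ‖w y‖ * ‖u - v‖ := by
                refine (norm_add_le _ _).trans ?_
                rw [norm_smul, norm_smul, norm_cfRep, norm_cfRep]
            _ ≤ (2 * ‖s‖ * |x - y|) * Mh + 1 * (Lh * |x - y|) := by
                gcongr
                · exact norm_cfWt_pair_sub_le hs (hA a' ha') hx0 hy0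
                · exact hb a ha a' ha' x hx
                · exact norm_cfWt_pair_le_one hs a a' hy0
                · exact hl a ha a' ha' x hx y hy
            _ = (2 * ‖s‖ * Mh + Lh) * |x - y| := by ring
      _ = (A.card : ℝ) ^ 2 * (2 * ‖s‖ * Mh + Lh) * |x - y| := by simp [Finset.sum_const, nsmul_eq_mul]; ring

end LipStep

/-! ### Lipschitz functions on `[0,1]` from functions on `ℝ`, and the two-step extension -/

namespace CfLip

/-- A function `ℝ → ℂ` that is Lipschitz on `[0,1]` as an element of `CfLip` (junk value `0` otherwise).
[folklore] -/
def ofFun (φ : ℝ → ℂ) : CfLip := by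
  classical
  exact if h : ∃ C : ℝ, ∀ x y : Icc (0 : ℝ) 1, ‖φ x - φ y‖ ≤ C * |(x : ℝ) - y| then
    mk' (fun x => φ x) h.choose h.choose_spec else 0

/-- Evaluation of `ofFun` under a Lipschitz hypothesis. [folklore] -/
theorem ofFun_apply {φ : ℝ → ℂ} (h : ∃ C : ℝ, ∀ x y : Icc (0 : ℝ) 1, ‖φ x - φ y‖ ≤ C * |(x : ℝ) - y|)
    (x : Icc (0 : ℝ) 1) : ofFun φ x = φ x := by
  classical
  unfold ofFun
  rw [dif_pos h, mk'_apply]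

/-- Norm bound for `ofFun`. [folklore] -/
theorem norm_ofFun_le {φ : ℝ → ℂ} {M C : ℝ} (hC : 0 ≤ C) (hM : ∀ x : Icc (0 : ℝ) 1, ‖φ x‖ ≤ M)
    (hL : ∀ x y : Icc (0 : ℝ) 1, ‖φ x - φ y‖ ≤ C * |(x : ℝ) - y|) : ‖ofFun φ‖ ≤ M + C := by
  have h : ∃ C : ℝ, ∀ x y : Icc (0 : ℝ) 1, ‖φ x - φ y‖ ≤ C * |(x : ℝ) - y| := ⟨C, hL⟩
  refine norm_le_of_bounds hC (fun x => ?_) (fun x y => ?_)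
  · rw [ofFun_apply h]; exact hM x
  · rw [ofFun_apply h, ofFun_apply h]; exact hL x y

end CfLip

section Ext2

variable (A) (hA : ∀ a ∈ A, 1 ≤ a) (q : ℕ) [NeZero q]

/-- **The two-step extension** of `g : ℝ → ℂ^{Γ_q}` to a family in `Γ_q → CfLip`:
`(Ext g)_η = (𝓛²_{s,q} g)_η|_{[0,1]}` (two steps of the dynamics bring `[0,1]` into `I`, where `g` is
controlled). [cite: MageeOhWinter2019, §3.2] -/
def cfExt2 (s : ℂ) (g : ℝ → CfVec q) : SL(2, ZMod q) → CfLip :=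
  fun η => CfLip.ofFun fun x => cfCongL A q s (cfCongL A q s g) x η

variable {A q}

include hA in
/-- **Sup and Lipschitz control of `𝓛 g` on `I_A`** for `g` bounded by `M` on `I` and cylinderwise
`L`-Lipschitz: `‖𝓛 g‖ ≤ #A² M` and `𝓛 g` is `#A²(2‖s‖M + L)`-Lipschitz on `I_A`. [cite: MageeOhWinter2019, Lemma 23] -/
theorem cfCongL_bounds_cfIA {s : ℂ} (hs : 0 ≤ s.re) {g : ℝ → CfVec q} {M L : ℝ} (hL : 0 ≤ L)
    (hgM : ∀ x ∈ cfI A, ‖g x‖ ≤ M)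
    (hgL : ∀ a ∈ A, ∀ a' ∈ A, ∀ x ∈ cfCyl A a a', ∀ y ∈ cfCyl A a a', ‖g x - g y‖ ≤ L * |x - y|) :
    (∀ x ∈ cfIA A, ‖cfCongL A q s g x‖ ≤ (A.card : ℝ) ^ 2 * M) ∧
    (∀ x ∈ cfIA A, ∀ y ∈ cfIA A, ‖cfCongL A q s g x - cfCongL A q s g y‖ ≤ (A.card : ℝ) ^ 2 * (2 * ‖s‖ * M + L) * |x - y|) := by
  refine cfCongL_lipStep A hA hs (fun x hx => (cfIA_subset_Icc A hx).1) (fun a ha a' ha' x hx =>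
    hgM _ (cfCyl_subset_cfI ha ha' (cfMoeb_pair_mem_cfCyl a a' hx))) fun a ha a' ha' x hx y hy => ?_
  have hx0 := (cfIA_subset_Icc A hx).1
  have hy0 := (cfIA_subset_Icc A hy).1
  exact (hgL a ha a' ha' _ (cfMoeb_pair_mem_cfCyl a a' hx) _ (cfMoeb_pair_mem_cfCyl a a' hy)).trans
    (mul_le_mul_of_nonneg_left (abs_cfMoeb_pair_sub_le (hA a ha) (hA a' ha') hx0 hy0) hL)

include hA in
/-- **Sup and Lipschitz control of `𝓛² g` on `[0,1]`**: `‖𝓛² g‖ ≤ #A⁴ M` and `𝓛² g` is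
`#A⁴((2‖s‖)² M + 2‖s‖ M + 2‖s‖ M + L)`-Lipschitz … stated as `#A⁴ (4‖s‖(1+‖s‖) M + L)`. [cite: MageeOhWinter2019, Lemma 23] -/
theorem cfCongL_two_bounds_Icc {s : ℂ} (hs : 0 ≤ s.re) {g : ℝ → CfVec q} {M L : ℝ} (hM : 0 ≤ M) (hL : 0 ≤ L)
    (hgM : ∀ x ∈ cfI A, ‖g x‖ ≤ M)
    (hgL : ∀ a ∈ A, ∀ a' ∈ A, ∀ x ∈ cfCyl A a a', ∀ y ∈ cfCyl A a a', ‖g x - g y‖ ≤ L * |x - y|) :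
    (∀ x ∈ Icc (0 : ℝ) 1, ‖cfCongL A q s (cfCongL A q s g) x‖ ≤ (A.card : ℝ) ^ 4 * M) ∧
    (∀ x ∈ Icc (0 : ℝ) 1, ∀ y ∈ Icc (0 : ℝ) 1, ‖cfCongL A q s (cfCongL A q s g) x - cfCongL A q s (cfCongL A q s g) y‖ ≤
      (A.card : ℝ) ^ 4 * (4 * ‖s‖ * (1 + ‖s‖) * M + L) * |x - y|) := by
  obtain ⟨h1, h2⟩ := cfCongL_bounds_cfIA hA hs hL hgM hgL
  obtain ⟨k1, k2⟩ := cfCongL_lipStep A hA hs (S := Icc (0 : ℝ) 1) (fun x hx => hx.1)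
    (fun a ha a' ha' x hx => h1 _ (cfMoeb_pair_mem_cfIA ha (hA a ha) (hA a' ha') hx))
    (fun a ha a' ha' x hx y hy => (h2 _ (cfMoeb_pair_mem_cfIA ha (hA a ha) (hA a' ha') hx) _
      (cfMoeb_pair_mem_cfIA ha (hA a ha) (hA a' ha') hy)).trans
      (mul_le_mul_of_nonneg_left (abs_cfMoeb_pair_sub_le (hA a ha) (hA a' ha') hx.1 hy.1) (by positivity)))
  refine ⟨fun x hx => (k1 x hx).trans (le_of_eq (by ring)), fun x hx y hy => (k2 x hx y hy).trans ?_⟩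
  have hc : (1 : ℝ) ≤ (A.card : ℝ) ^ 2 ∨ A.card = 0 := by
    rcases Nat.eq_zero_or_pos A.card with h | h
    · exact Or.inr h
    · left; have : (1 : ℝ) ≤ A.card := by exact_mod_cast h
      nlinarith
  rcases hc with hc | hc
  · have hxy := abs_nonneg (x - y)
    have hs0 := norm_nonneg s
    -- `#A²(2‖s‖ #A² M + #A²(2‖s‖M + L)) ≤ #A⁴(4‖s‖(1+‖s‖)M + L)`
    have key : (A.card : ℝ) ^ 2 * (2 * ‖s‖ * ((A.card : ℝ) ^ 2 * M) + (A.card : ℝ) ^ 2 * (2 * ‖s‖ * M + L)) ≤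
        (A.card : ℝ) ^ 4 * (4 * ‖s‖ * (1 + ‖s‖) * M + L) := by
      have : (A.card : ℝ) ^ 2 * (2 * ‖s‖ * ((A.card : ℝ) ^ 2 * M) + (A.card : ℝ) ^ 2 * (2 * ‖s‖ * M + L)) =
          (A.card : ℝ) ^ 4 * (4 * ‖s‖ * M + L) := by ring
      rw [this]
      refine mul_le_mul_of_nonneg_left ?_ (by positivity)
      nlinarith [mul_nonneg hs0 hM, mul_nonneg (mul_nonneg hs0 hs0) hM]
    exact mul_le_mul_of_nonneg_right key hxy
  · simp [hc]

include hA in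
/-- Components of the two-step extension: `(Ext g)_η(x) = (𝓛² g)(x)_η` on `[0,1]`.
[cite: MageeOhWinter2019, §3.2] -/
theorem cfExt2_apply {s : ℂ} (hs : 0 ≤ s.re) {g : ℝ → CfVec q} {M L : ℝ} (hM : 0 ≤ M) (hL : 0 ≤ L)
    (hgM : ∀ x ∈ cfI A, ‖g x‖ ≤ M)
    (hgL : ∀ a ∈ A, ∀ a' ∈ A, ∀ x ∈ cfCyl A a a', ∀ y ∈ cfCyl A a a', ‖g x - g y‖ ≤ L * |x - y|)
    (η : SL(2, ZMod q)) (x : Icc (0 : ℝ) 1) :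
    cfExt2 A q s g η x = cfCongL A q s (cfCongL A q s g) x η := by
  obtain ⟨-, k2⟩ := cfCongL_two_bounds_Icc hA hs hM hL hgM hgL
  refine CfLip.ofFun_apply ⟨(A.card : ℝ) ^ 4 * (4 * ‖s‖ * (1 + ‖s‖) * M + L), fun x y => ?_⟩ x
  calc ‖cfCongL A q s (cfCongL A q s g) x η - cfCongL A q s (cfCongL A q s g) y η‖
      = ‖(cfCongL A q s (cfCongL A q s g) x - cfCongL A q s (cfCongL A q s g) y) η‖ := by rw [PiLp.sub_apply]
    _ ≤ ‖cfCongL A q s (cfCongL A q s g) x - cfCongL A q s (cfCongL A q s g) y‖ := norm_apply_le_norm_cfVec _ _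
    _ ≤ _ := k2 x x.2 y y.2

include hA in
/-- **The vector form of the two-step extension is `𝓛² g` on `[0,1]`.** [cite: MageeOhWinter2019, §3.2] -/
theorem cfVecOf_cfExt2 {s : ℂ} (hs : 0 ≤ s.re) {g : ℝ → CfVec q} {M L : ℝ} (hM : 0 ≤ M) (hL : 0 ≤ L)
    (hgM : ∀ x ∈ cfI A, ‖g x‖ ≤ M)
    (hgL : ∀ a ∈ A, ∀ a' ∈ A, ∀ x ∈ cfCyl A a a', ∀ y ∈ cfCyl A a a', ‖g x - g y‖ ≤ L * |x - y|)
    {x : ℝ} (hx : x ∈ Icc (0 : ℝ) 1) : cfVecOf (cfExt2 A q s g) x = cfCongL A q s (cfCongL A q s g) x := by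
  ext η
  rw [cfVecOf_apply, CfLip.extend_of_mem _ hx, cfExt2_apply hA hs hM hL hgM hgL]

include hA in
/-- **Sup bound for the two-step extension:** `|(Ext g)_η(x)| ≤ #A⁴ M`. [cite: MageeOhWinter2019, Lemma 23] -/
theorem norm_cfExt2_apply_le {s : ℂ} (hs : 0 ≤ s.re) {g : ℝ → CfVec q} {M L : ℝ} (hM : 0 ≤ M) (hL : 0 ≤ L)
    (hgM : ∀ x ∈ cfI A, ‖g x‖ ≤ M)
    (hgL : ∀ a ∈ A, ∀ a' ∈ A, ∀ x ∈ cfCyl A a a', ∀ y ∈ cfCyl A a a', ‖g x - g y‖ ≤ L * |x - y|)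
    (η : SL(2, ZMod q)) (x : Icc (0 : ℝ) 1) : ‖cfExt2 A q s g η x‖ ≤ (A.card : ℝ) ^ 4 * M := by
  rw [cfExt2_apply hA hs hM hL hgM hgL]
  exact (norm_apply_le_norm_cfVec _ _).trans ((cfCongL_two_bounds_Icc hA hs hM hL hgM hgL).1 x x.2)

include hA in
/-- **Norm bound for the two-step extension** in `Γ_q → CfLip`:
`‖Ext g‖ ≤ #A⁴ M + #A⁴ (4‖s‖(1+‖s‖) M + L)`. [cite: MageeOhWinter2019, Lemma 23] -/
theorem norm_cfExt2_le {s : ℂ} (hs : 0 ≤ s.re) {g : ℝ → CfVec q} {M L : ℝ} (hM : 0 ≤ M) (hL : 0 ≤ L)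
    (hgM : ∀ x ∈ cfI A, ‖g x‖ ≤ M)
    (hgL : ∀ a ∈ A, ∀ a' ∈ A, ∀ x ∈ cfCyl A a a', ∀ y ∈ cfCyl A a a', ‖g x - g y‖ ≤ L * |x - y|) :
    ‖cfExt2 A q s g‖ ≤ (A.card : ℝ) ^ 4 * M + (A.card : ℝ) ^ 4 * (4 * ‖s‖ * (1 + ‖s‖) * M + L) := by
  have hpos : 0 ≤ (A.card : ℝ) ^ 4 * M + (A.card : ℝ) ^ 4 * (4 * ‖s‖ * (1 + ‖s‖) * M + L) := by positivity
  rw [pi_norm_le_iff_of_nonneg hpos]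
  intro η
  obtain ⟨k1, k2⟩ := cfCongL_two_bounds_Icc hA hs hM hL hgM hgL
  refine CfLip.norm_ofFun_le (by positivity) (fun x => (norm_apply_le_norm_cfVec _ _).trans (k1 x x.2)) fun x y => ?_
  calc ‖cfCongL A q s (cfCongL A q s g) x η - cfCongL A q s (cfCongL A q s g) y η‖
      = ‖(cfCongL A q s (cfCongL A q s g) x - cfCongL A q s (cfCongL A q s g) y) η‖ := by rw [PiLp.sub_apply]
    _ ≤ ‖cfCongL A q s (cfCongL A q s g) x - cfCongL A q s (cfCongL A q s g) y‖ := norm_apply_le_norm_cfVec _ _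
    _ ≤ _ := k2 x x.2 y y.2

end Ext2

/-! ### Locality and invariance of the iterates on `I` -/

section Iterates

variable (A) {q : ℕ} [NeZero q] (hA : ∀ a ∈ A, 1 ≤ a)

include hA in
/-- **Locality of the iterates:** on `I`, `𝓛^m h` only depends on `h|_I`. [folklore] -/
theorem cfCongL_iterate_congr_of_eqOn (s : ℂ) {F G : ℝ → CfVec q} (h : EqOn F G (cfI A)) (m : ℕ) :
    EqOn ((cfCongL A q s)^[m] F) ((cfCongL A q s)^[m] G) (cfI A) := by
  induction m with
  | zero => exact h
  | succ m ih =>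
    intro x hx
    rw [Function.iterate_succ_apply', Function.iterate_succ_apply']
    exact cfCongL_congr_of_eqOn A s ih (cfI_subset_cfIA hA hx)

include hA in
/-- **Two steps see only `I`:** if `h = 0` on `I` then `𝓛(𝓛 h) = 0` on `[0,1]`. [cite: MageeOhWinter2019, §2.1 (II)] -/
theorem cfCongL_two_eq_zero_of_eqOn (s : ℂ) {h : ℝ → CfVec q} (h0 : ∀ x ∈ cfI A, h x = 0) {x : ℝ}
    (hx : x ∈ Icc (0 : ℝ) 1) : cfCongL A q s (cfCongL A q s h) x = 0 := by
  have h1 : ∀ y ∈ cfIA A, cfCongL A q s h y = 0 := fun y hy => by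
    rw [cfCongL_congr_of_eqOn A s (G := 0) (fun z hz => h0 z hz) hy, cfCongL_zero]
  rw [cfCongL_congr A s (G := 0) (fun a ha a' ha' => ?_), cfCongL_zero]
  exact h1 _ (cfMoeb_pair_mem_cfIA ha (hA a ha) (hA a' ha') hx)

variable {E' : Type*} [NormedAddCommGroup E'] [NormedSpace ℂ E']

/-- A (complex-)linear constraint `ℓ = 0` that is stable under all `ρ(g)` is inherited by `𝓛 F` at `x`
from the values `F(g_a g_{a'} x)`. [folklore] -/
theorem apply_cfCongL_eq_zero (ℓ : CfVec q →L[ℂ] E') (hℓ : ∀ (g : SL(2, ZMod q)) (v : CfVec q), ℓ v = 0 → ℓ (cfRep g v) = 0)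
    (s : ℂ) {F : ℝ → CfVec q} {x : ℝ}
    (h : ∀ a ∈ A, ∀ a' ∈ A, ℓ (F (cfMoeb (cfGen a * cfGen a') x)) = 0) : ℓ (cfCongL A q s F x) = 0 := by
  unfold cfCongL
  rw [map_sum]
  refine Finset.sum_eq_zero fun a ha => ?_
  rw [map_sum]
  refine Finset.sum_eq_zero fun a' ha' => ?_
  rw [map_smul, hℓ _ _ (h a ha a' ha'), smul_zero]

include hA in
/-- The constraint propagates from `I` to the iterates on `I`. [folklore] -/
theorem apply_cfCongL_iterate_eq_zero (ℓ : CfVec q →L[ℂ] E')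
    (hℓ : ∀ (g : SL(2, ZMod q)) (v : CfVec q), ℓ v = 0 → ℓ (cfRep g v) = 0) (s : ℂ) {F : ℝ → CfVec q}
    (h : ∀ x ∈ cfI A, ℓ (F x) = 0) (m : ℕ) : ∀ x ∈ cfI A, ℓ ((cfCongL A q s)^[m] F x) = 0 := by
  induction m with
  | zero => exact h
  | succ m ih =>
    intro x hx
    rw [Function.iterate_succ_apply']
    exact apply_cfCongL_eq_zero A ℓ hℓ s fun a ha a' ha' =>
      ih _ (cfCyl_subset_cfI ha ha' (cfMoeb_pair_mem_cfCyl a a' (cfI_subset_cfIA hA hx)))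

/-- **`𝓛` commutes with pointwise convergent series.** [folklore] -/
theorem cfCongL_tsum (s : ℂ) {G : ℕ → ℝ → CfVec q} {x : ℝ}
    (hsum : ∀ a ∈ A, ∀ a' ∈ A, Summable fun m => G m (cfMoeb (cfGen a * cfGen a') x)) :
    cfCongL A q s (fun y => ∑' m, G m y) x = ∑' m, cfCongL A q s (G m) x := by
  have hterm : ∀ a ∈ A, ∀ a' ∈ A, Summable fun m =>
      cfWt s (cfGen a * cfGen a') x • cfRepL (cfRed q (cfPair a a')) (G m (cfMoeb (cfGen a * cfGen a') x)) :=
    fun a ha a' ha' => ((cfRepL (cfRed q (cfPair a a'))).summable (hsum a ha a' ha')).const_smul _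
  unfold cfCongL
  simp_rw [← cfRepL_apply]
  rw [Summable.tsum_finsetSum (fun a ha => summable_sum fun a' ha' => hterm a ha a' ha')]
  refine Finset.sum_congr rfl fun a ha => ?_
  rw [Summable.tsum_finsetSum (fun a' ha' => hterm a ha a' ha')]
  refine Finset.sum_congr rfl fun a' ha' => ?_
  rw [(cfRepL (cfRed q (cfPair a a'))).map_tsum (hsum a ha a' ha'),
    ← Summable.tsum_const_smul _ ((cfRepL (cfRed q (cfPair a a'))).summable (hsum a ha a' ha'))]

end Iterates

/-! ### The series `S g = Σ_m 𝓛^m g` under summable operator bounds -/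

section Series

variable (A) {q : ℕ} [NeZero q] (hA : ∀ a ∈ A, 1 ≤ a)
variable {E' : Type*} [NormedAddCommGroup E'] [NormedSpace ℂ E']

/-- The pointwise Neumann-type series `S g (x) = Σ_m (𝓛^m_{s,q} g)(x)`. [cite: MageeOhWinter2019, §3.2] -/
def cfSeries (A : Finset ℕ) (q : ℕ) [NeZero q] (s : ℂ) (g : ℝ → CfVec q) (x : ℝ) : CfVec q :=
  ∑' m, (cfCongL A q s)^[m] g x

variable {s : ℂ} {θ : ℝ} {β : ℕ → ℝ} (ℓ : CfVec q →L[ℂ] E')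

/-- The standing hypothesis of this section, spelled out: weighted operator bounds for the iterates on
piecewise Lipschitz, `ℓ`-constrained functions on `I` — `sup_I ‖𝓛^m g‖ ≤ β_m (M + θ L)` and
`𝓛^m g` cylinderwise `θ⁻¹ β_m (M + θ L)`-Lipschitz. (A `theorem` restating its own hypothesis, used only
to fix the shape once; `θ ∈ (0,1]` weights the Lipschitz part, `Σ β_m < ∞`.) [folklore] -/
theorem cfIterBound_shape
    (hβ : ∀ (m : ℕ) (g : ℝ → CfVec q) (M L : ℝ), 0 ≤ M → 0 ≤ L → (∀ x ∈ cfI A, ‖g x‖ ≤ M) →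
      (∀ a ∈ A, ∀ a' ∈ A, ∀ x ∈ cfCyl A a a', ∀ y ∈ cfCyl A a a', ‖g x - g y‖ ≤ L * |x - y|) →
      (∀ x ∈ cfI A, ℓ (g x) = 0) →
      (∀ x ∈ cfI A, ‖(cfCongL A q s)^[m] g x‖ ≤ β m * (M + θ * L)) ∧
      (∀ a ∈ A, ∀ a' ∈ A, ∀ x ∈ cfCyl A a a', ∀ y ∈ cfCyl A a a',
        ‖(cfCongL A q s)^[m] g x - (cfCongL A q s)^[m] g y‖ ≤ θ⁻¹ * (β m * (M + θ * L)) * |x - y|)) :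
    ∀ (m : ℕ) (g : ℝ → CfVec q) (M L : ℝ), 0 ≤ M → 0 ≤ L → (∀ x ∈ cfI A, ‖g x‖ ≤ M) →
      (∀ a ∈ A, ∀ a' ∈ A, ∀ x ∈ cfCyl A a a', ∀ y ∈ cfCyl A a a', ‖g x - g y‖ ≤ L * |x - y|) →
      (∀ x ∈ cfI A, ℓ (g x) = 0) →
      (∀ x ∈ cfI A, ‖(cfCongL A q s)^[m] g x‖ ≤ β m * (M + θ * L)) := fun m g M L hM hL h1 h2 h3 =>
  (hβ m g M L hM hL h1 h2 h3).1

variable (hθ : 0 < θ) (hβ0 : ∀ m, 0 ≤ β m) (hβs : Summable β)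
variable (hβ : ∀ (m : ℕ) (g : ℝ → CfVec q) (M L : ℝ), 0 ≤ M → 0 ≤ L → (∀ x ∈ cfI A, ‖g x‖ ≤ M) →
      (∀ a ∈ A, ∀ a' ∈ A, ∀ x ∈ cfCyl A a a', ∀ y ∈ cfCyl A a a', ‖g x - g y‖ ≤ L * |x - y|) →
      (∀ x ∈ cfI A, ℓ (g x) = 0) →
      (∀ x ∈ cfI A, ‖(cfCongL A q s)^[m] g x‖ ≤ β m * (M + θ * L)) ∧
      (∀ a ∈ A, ∀ a' ∈ A, ∀ x ∈ cfCyl A a a', ∀ y ∈ cfCyl A a a',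
        ‖(cfCongL A q s)^[m] g x - (cfCongL A q s)^[m] g y‖ ≤ θ⁻¹ * (β m * (M + θ * L)) * |x - y|))
variable {g : ℝ → CfVec q} {M L : ℝ} (hM : 0 ≤ M) (hL : 0 ≤ L) (hgM : ∀ x ∈ cfI A, ‖g x‖ ≤ M)
  (hgL : ∀ a ∈ A, ∀ a' ∈ A, ∀ x ∈ cfCyl A a a', ∀ y ∈ cfCyl A a a', ‖g x - g y‖ ≤ L * |x - y|)
  (hgℓ : ∀ x ∈ cfI A, ℓ (g x) = 0)

include hβ hM hL hgM hgL hgℓ hβs in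
/-- The series `Σ_m (𝓛^m g)(x)` converges absolutely on `I`. [folklore] -/
theorem summable_cfSeries {x : ℝ} (hx : x ∈ cfI A) : Summable fun m => (cfCongL A q s)^[m] g x :=
  Summable.of_norm_bounded (hβs.mul_right (M + θ * L)) fun m => (hβ m g M L hM hL hgM hgL hgℓ).1 x hx

include hβ hM hL hgM hgL hgℓ hβs in
/-- **Sup bound:** `‖S g (x)‖ ≤ (Σβ)(M + θ L)` on `I`. [folklore] -/
theorem norm_cfSeries_le {x : ℝ} (hx : x ∈ cfI A) : ‖cfSeries A q s g x‖ ≤ (∑' m, β m) * (M + θ * L) := by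
  rw [cfSeries, ← tsum_mul_right]
  exact tsum_of_norm_bounded (hβs.mul_right _).hasSum fun m => (hβ m g M L hM hL hgM hgL hgℓ).1 x hx

include hβ hM hL hgM hgL hgℓ hβs in
/-- **Cylinderwise Lipschitz bound:** `S g` is `θ⁻¹ (Σβ)(M + θL)`-Lipschitz on each cylinder. [folklore] -/
theorem norm_cfSeries_sub_le {a a' : ℕ} (ha : a ∈ A) (ha' : a' ∈ A) {x y : ℝ} (hx : x ∈ cfCyl A a a')
    (hy : y ∈ cfCyl A a a') :
    ‖cfSeries A q s g x - cfSeries A q s g y‖ ≤ θ⁻¹ * ((∑' m, β m) * (M + θ * L)) * |x - y| := by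
  have hxI := cfCyl_subset_cfI ha ha' hx
  have hyI := cfCyl_subset_cfI ha ha' hy
  rw [cfSeries, cfSeries, ← Summable.tsum_sub (summable_cfSeries A ℓ hβs hβ hM hL hgM hgL hgℓ hxI)
    (summable_cfSeries A ℓ hβs hβ hM hL hgM hgL hgℓ hyI)]
  have e : ∑' m, θ⁻¹ * (β m * (M + θ * L)) * |x - y| = θ⁻¹ * ((∑' m, β m) * (M + θ * L)) * |x - y| := by
    rw [tsum_mul_right, tsum_mul_left, tsum_mul_right]
  rw [← e]
  exact tsum_of_norm_bounded (((hβs.mul_right _).mul_left _).mul_right _).hasSum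
    fun m => (hβ m g M L hM hL hgM hgL hgℓ).2 a ha a' ha' x hx y hy

include hA hβ hM hL hgM hgL hgℓ hβs in
/-- The constraint is inherited by `S g` on `I` (when it is `ρ`-stable). [folklore] -/
theorem apply_cfSeries_eq_zero (hℓ : ∀ (g : SL(2, ZMod q)) (v : CfVec q), ℓ v = 0 → ℓ (cfRep g v) = 0)
    {x : ℝ} (hx : x ∈ cfI A) : ℓ (cfSeries A q s g x) = 0 := by
  rw [cfSeries, ℓ.map_tsum (summable_cfSeries A ℓ hβs hβ hM hL hgM hgL hgℓ hx)]
  simp only [apply_cfCongL_iterate_eq_zero A hA ℓ hℓ s hgℓ _ x hx, tsum_zero]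

include hA hβ hM hL hgM hgL hgℓ hβs in
/-- **`S` is a right inverse of `1 - 𝓛` on `I`:** `S g (x) - 𝓛(S g)(x) = g(x)` for `x ∈ I`
(`𝓛` commutes with the series, which then telescopes). [cite: MageeOhWinter2019, §3.2] -/
theorem cfSeries_sub_cfCongL_cfSeries {x : ℝ} (hx : x ∈ cfI A) :
    cfSeries A q s g x - cfCongL A q s (cfSeries A q s g) x = g x := by
  have hsumx := summable_cfSeries A ℓ hβs hβ hM hL hgM hgL hgℓ hx
  have hL' : cfCongL A q s (cfSeries A q s g) x = ∑' m, (cfCongL A q s)^[m + 1] g x := by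
    unfold cfSeries
    rw [cfCongL_tsum A s (fun a ha a' ha' => summable_cfSeries A ℓ hβs hβ hM hL hgM hgL hgℓ
      (cfCyl_subset_cfI ha ha' (cfMoeb_pair_mem_cfCyl a a' (cfI_subset_cfIA hA hx))))]
    exact tsum_congr fun m => by rw [Function.iterate_succ_apply']
  rw [hL', cfSeries, hsumx.tsum_eq_zero_add]
  simp only [Function.iterate_zero, id_eq, add_sub_cancel_right]

include hA hβ hM hL hgM hgL hgℓ hβs in
/-- **Injectivity of `1 - 𝓛` on `I`:** if `g = 𝓛 g` on `I` (for a bounded, cylinderwise Lipschitz,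
constrained `g`) then `g = 0` on `I` (`g = 𝓛^m g → 0`). [cite: MageeOhWinter2019, §3.2] -/
theorem eq_zero_of_cfCongL_eq (hfix : ∀ x ∈ cfI A, cfCongL A q s g x = g x) {x : ℝ} (hx : x ∈ cfI A) : g x = 0 := by
  have hiter : ∀ m, ∀ y ∈ cfI A, (cfCongL A q s)^[m] g y = g y := by
    intro m
    induction m with
    | zero => intro y _; rfl
    | succ m ih =>
      intro y hy
      rw [Function.iterate_succ_apply, cfCongL_iterate_congr_of_eqOn A hA s (fun z hz => hfix z hz) m hy]
      exact ih y hy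
  have hbound : ∀ m, ‖g x‖ ≤ β m * (M + θ * L) := fun m => by
    rw [← hiter m x hx]; exact (hβ m g M L hM hL hgM hgL hgℓ).1 x hx
  have hlim : Tendsto (fun m => β m * (M + θ * L)) atTop (𝓝 0) := by
    simpa using hβs.tendsto_atTop_zero.mul_const (M + θ * L)
  have h0 : ‖g x‖ ≤ 0 := ge_of_tendsto' hlim hbound
  exact norm_le_zero_iff.1 h0

end Series

/-! ### Bijectivity of `1 - 𝓜_s` on (constrained) families -/

section Core

variable (A) (hA : ∀ a ∈ A, 1 ≤ a) (q : ℕ) [NeZero q]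
variable {E' : Type*} [NormedAddCommGroup E'] [NormedSpace ℂ E']
variable {s : ℂ} (hs : 0 ≤ s.re) {θ : ℝ} (hθ : 0 < θ) {β : ℕ → ℝ} (hβ0 : ∀ m, 0 ≤ β m) (hβs : Summable β)
variable (ℓ : CfVec q →L[ℂ] E') (hℓ : ∀ (g : SL(2, ZMod q)) (v : CfVec q), ℓ v = 0 → ℓ (cfRep g v) = 0)
variable (hβ : ∀ (m : ℕ) (g : ℝ → CfVec q) (M L : ℝ), 0 ≤ M → 0 ≤ L → (∀ x ∈ cfI A, ‖g x‖ ≤ M) →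
      (∀ a ∈ A, ∀ a' ∈ A, ∀ x ∈ cfCyl A a a', ∀ y ∈ cfCyl A a a', ‖g x - g y‖ ≤ L * |x - y|) →
      (∀ x ∈ cfI A, ℓ (g x) = 0) →
      (∀ x ∈ cfI A, ‖(cfCongL A q s)^[m] g x‖ ≤ β m * (M + θ * L)) ∧
      (∀ a ∈ A, ∀ a' ∈ A, ∀ x ∈ cfCyl A a a', ∀ y ∈ cfCyl A a a',
        ‖(cfCongL A q s)^[m] g x - (cfCongL A q s)^[m] g y‖ ≤ θ⁻¹ * (β m * (M + θ * L)) * |x - y|))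

/-- The preimage candidate `Φ = G + 𝓜 G + Ext(S(vec G))`. [cite: MageeOhWinter2019, §3.2] -/
def cfPreimage (hA : ∀ a ∈ A, 1 ≤ a) (s : ℂ) (G : SL(2, ZMod q) → CfLip) : SL(2, ZMod q) → CfLip :=
  G + cfTwist A hA q s G + cfExt2 A q s (cfSeries A q s (cfVecOf G))

variable {A q}

/-- `𝓛` is subtractive as a map of functions. [folklore] -/
theorem cfCongL_sub_fun (s : ℂ) (F G : ℝ → CfVec q) : cfCongL A q s (F - G) = cfCongL A q s F - cfCongL A q s G :=
  funext fun x => cfCongL_sub A s F G x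

include hA hs hθ hβ0 hβs hℓ hβ in
/-- **Surjectivity with bounds.** For a family `G` with `|G_η| ≤ M_G`, each `G_η` `L_G`-Lipschitz and
`ℓ(vec G) = 0` on `[0,1]`, the family `Φ = cfPreimage G` satisfies `(1 - 𝓜_s) Φ = G`, `ℓ(vec Φ) = 0` on
`[0,1]`, and `|Φ_η(y)| ≤ M_G + #A² √|Γ_q| M_G + #A⁴ (Σβ) √|Γ_q| (M_G + θ L_G)`.
[cite: MageeOhWinter2019, §3.2 and Thm. 4] -/
theorem cfPreimage_spec (G : SL(2, ZMod q) → CfLip) {MG LG : ℝ} (hMG : 0 ≤ MG) (hLG : 0 ≤ LG)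
    (hGM : ∀ η (y : Icc (0 : ℝ) 1), ‖G η y‖ ≤ MG)
    (hGL : ∀ η (x y : Icc (0 : ℝ) 1), ‖G η x - G η y‖ ≤ LG * |(x : ℝ) - y|)
    (hGℓ : ∀ x ∈ Icc (0 : ℝ) 1, ℓ (cfVecOf G x) = 0) :
    (1 - cfTwist A hA q s) (cfPreimage A q hA s G) = G ∧
    (∀ x ∈ Icc (0 : ℝ) 1, ℓ (cfVecOf (cfPreimage A q hA s G) x) = 0) ∧
    (∀ η (y : Icc (0 : ℝ) 1), ‖cfPreimage A q hA s G η y‖ ≤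
      MG + (A.card : ℝ) ^ 2 * (Real.sqrt (Fintype.card (SL(2, ZMod q))) * MG) +
        (A.card : ℝ) ^ 4 * ((∑' m, β m) * (Real.sqrt (Fintype.card (SL(2, ZMod q))) * MG +
          θ * (Real.sqrt (Fintype.card (SL(2, ZMod q))) * LG)))) := by
  set CΓ : ℝ := Real.sqrt (Fintype.card (SL(2, ZMod q))) with hCΓ
  have hCΓ0 : 0 ≤ CΓ := Real.sqrt_nonneg _
  set g : ℝ → CfVec q := cfVecOf G with hg
  -- control of `g = vec G` : everywhere bounded by `CΓ MG`, `CΓ LG`-Lipschitz on `[0,1]`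
  have hgM' : ∀ x, ‖g x‖ ≤ CΓ * MG := fun x => norm_cfVecOf_le G hMG hGM x
  have hgM : ∀ x ∈ cfI A, ‖g x‖ ≤ CΓ * MG := fun x _ => hgM' x
  have hgL01 : ∀ x ∈ Icc (0 : ℝ) 1, ∀ y ∈ Icc (0 : ℝ) 1, ‖g x - g y‖ ≤ CΓ * LG * |x - y| := fun x hx y hy => by
    have := norm_cfVecOf_sub_le G hLG hGL hx hy; rw [← hCΓ] at this; linarith [this]
  have hgL : ∀ a ∈ A, ∀ a' ∈ A, ∀ x ∈ cfCyl A a a', ∀ y ∈ cfCyl A a a', ‖g x - g y‖ ≤ CΓ * LG * |x - y| :=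
    fun a ha a' ha' x hx y hy => hgL01 x (cfI_subset_Icc hA (cfCyl_subset_cfI ha ha' hx)) y
      (cfI_subset_Icc hA (cfCyl_subset_cfI ha ha' hy))
  have hgℓ : ∀ x ∈ cfI A, ℓ (g x) = 0 := fun x hx => hGℓ x (cfI_subset_Icc hA hx)
  have hM0 : 0 ≤ CΓ * MG := by positivity
  have hL0 : 0 ≤ CΓ * LG := by positivity
  -- the series `f = S g` and its control on `I`
  set f : ℝ → CfVec q := cfSeries A q s g with hf
  set Sβ : ℝ := ∑' m, β m with hSβ
  have hSβ0 : 0 ≤ Sβ := tsum_nonneg hβ0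
  set M1 : ℝ := Sβ * (CΓ * MG + θ * (CΓ * LG)) with hM1
  have hM10 : 0 ≤ M1 := by positivity
  have hL10 : 0 ≤ θ⁻¹ * M1 := by positivity
  have hfM : ∀ x ∈ cfI A, ‖f x‖ ≤ M1 := fun x hx => norm_cfSeries_le A ℓ hβs hβ hM0 hL0 hgM hgL hgℓ hx
  have hfL : ∀ a ∈ A, ∀ a' ∈ A, ∀ x ∈ cfCyl A a a', ∀ y ∈ cfCyl A a a', ‖f x - f y‖ ≤ θ⁻¹ * M1 * |x - y| :=
    fun a ha a' ha' x hx y hy => norm_cfSeries_sub_le A ℓ hβs hβ hM0 hL0 hgM hgL hgℓ ha ha' hx hy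
  have hfℓ : ∀ x ∈ cfI A, ℓ (f x) = 0 := fun x hx => apply_cfSeries_eq_zero A hA ℓ hβs hβ hM0 hL0 hgM hgL hgℓ hℓ hx
  have hfix : ∀ x ∈ cfI A, f x - cfCongL A q s f x = g x :=
    fun x hx => cfSeries_sub_cfCongL_cfSeries A hA ℓ hβs hβ hM0 hL0 hgM hgL hgℓ hx
  -- vector form of `Φ` on `[0,1]`
  have hvecΦ : ∀ x ∈ Icc (0 : ℝ) 1, cfVecOf (cfPreimage A q hA s G) x =
      g x + cfCongL A q s g x + cfCongL A q s (cfCongL A q s f) x := fun x hx => by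
    rw [cfPreimage, cfVecOf_add, cfVecOf_add, cfVecOf_cfTwist A q hA s G hx, cfVecOf_cfExt2 hA hs hM10 hL10 hfM hfL hx]
  have hmem : ∀ {x : ℝ}, x ∈ Icc (0 : ℝ) 1 → ∀ a ∈ A, ∀ a' ∈ A, cfMoeb (cfGen a * cfGen a') x ∈ Icc (0 : ℝ) 1 :=
    fun hx a ha a' ha' => cfIA_subset_Icc A (cfMoeb_pair_mem_cfIA ha (hA a ha) (hA a' ha') hx)
  refine ⟨?_, ?_, ?_⟩
  · -- (1) `(1 - 𝓜)Φ = G`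
    refine eq_of_cfVecOf_eq fun x hx => ?_
    rw [show (1 - cfTwist A hA q s) (cfPreimage A q hA s G) = cfPreimage A q hA s G - cfTwist A hA q s (cfPreimage A q hA s G)
      from rfl, cfVecOf_sub, cfVecOf_cfTwist A q hA s _ hx, hvecΦ x hx]
    have hloc : cfCongL A q s (cfVecOf (cfPreimage A q hA s G)) x =
        cfCongL A q s ((g + cfCongL A q s g) + cfCongL A q s (cfCongL A q s f)) x :=
      cfCongL_congr A s fun a ha a' ha' => by rw [hvecΦ _ (hmem hx a ha a' ha')]; rfl
    rw [hloc, cfCongL_add, cfCongL_add]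
    have hkey : cfCongL A q s (cfCongL A q s (f - cfCongL A q s f - g)) x = 0 :=
      cfCongL_two_eq_zero_of_eqOn A hA s (fun y hy => by simp only [Pi.sub_apply, hfix y hy, sub_self]) hx
    rw [cfCongL_sub_fun, cfCongL_sub_fun, Pi.sub_apply, cfCongL_sub_fun, cfCongL_sub_fun, Pi.sub_apply] at hkey
    have e : g x + cfCongL A q s g x + cfCongL A q s (cfCongL A q s f) x -
        (cfCongL A q s g x + cfCongL A q s (cfCongL A q s g) x + cfCongL A q s (cfCongL A q s (cfCongL A q s f)) x) =
        g x + (cfCongL A q s (cfCongL A q s f) x - cfCongL A q s (cfCongL A q s (cfCongL A q s f)) x -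
          cfCongL A q s (cfCongL A q s g) x) := by abel
    rw [e, hkey, add_zero]
  · -- (2) the constraint
    intro x hx
    rw [hvecΦ x hx, map_add, map_add, hGℓ x hx, zero_add]
    rw [apply_cfCongL_eq_zero A ℓ hℓ s (fun a ha a' ha' => hGℓ _ (hmem hx a ha a' ha')), zero_add]
    refine apply_cfCongL_eq_zero A ℓ hℓ s fun a ha a' ha' => apply_cfCongL_eq_zero A ℓ hℓ s fun b hb b' hb' => hfℓ _ ?_
    exact cfCyl_subset_cfI hb hb' (cfMoeb_pair_mem_cfCyl b b' (cfMoeb_pair_mem_cfIA ha (hA a ha) (hA a' ha') hx))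
  · -- (3) the bound
    intro η y
    have hLg := cfCongL_lipStep A hA hs (S := Icc (0 : ℝ) 1) (fun x hx => hx.1) (h := g) (Mh := CΓ * MG) (Lh := CΓ * LG)
      (fun a ha a' ha' x hx => hgM' _)
      (fun a ha a' ha' x hx y hy => (hgL01 _ (hmem hx a ha a' ha') _ (hmem hy a ha a' ha')).trans
        (mul_le_mul_of_nonneg_left (abs_cfMoeb_pair_sub_le (hA a ha) (hA a' ha') hx.1 hy.1) hL0))
    have h2 : ‖cfTwist A hA q s G η y‖ ≤ (A.card : ℝ) ^ 2 * (CΓ * MG) := by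
      have e : cfTwist A hA q s G η y = cfVecOf (cfTwist A hA q s G) y η := by
        rw [cfVecOf_apply, CfLip.extend_coe]
      rw [e, cfVecOf_cfTwist A q hA s G y.2]
      exact (norm_apply_le_norm_cfVec _ _).trans (hLg.1 y y.2)
    have h3 : ‖cfExt2 A q s f η y‖ ≤ (A.card : ℝ) ^ 4 * M1 := norm_cfExt2_apply_le hA hs hM10 hL10 hfM hfL η y
    calc ‖cfPreimage A q hA s G η y‖ = ‖G η y + cfTwist A hA q s G η y + cfExt2 A q s f η y‖ := rfl
      _ ≤ ‖G η y‖ + ‖cfTwist A hA q s G η y‖ + ‖cfExt2 A q s f η y‖ := norm_add₃_le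
      _ ≤ MG + (A.card : ℝ) ^ 2 * (CΓ * MG) + (A.card : ℝ) ^ 4 * M1 := add_le_add_three (hGM η y) h2 h3
      _ = _ := by rw [hM1]

include hA hβs hβ in
/-- **Injectivity.** A constrained family with `(1 - 𝓜_s) Φ = 0` vanishes. [cite: MageeOhWinter2019, §3.2 and Thm. 4] -/
theorem eq_zero_of_cfTwist_eq (Φ : SL(2, ZMod q) → CfLip) (hΦℓ : ∀ x ∈ Icc (0 : ℝ) 1, ℓ (cfVecOf Φ x) = 0)
    (h0 : (1 - cfTwist A hA q s) Φ = 0) : Φ = 0 := by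
  set CΓ : ℝ := Real.sqrt (Fintype.card (SL(2, ZMod q))) with hCΓ
  set g : ℝ → CfVec q := cfVecOf Φ with hg
  have hΦM : ∀ η (y : Icc (0 : ℝ) 1), ‖Φ η y‖ ≤ ‖Φ‖ := fun η y => ((Φ η).norm_apply_le y).trans (norm_le_pi_norm Φ η)
  have hΦL : ∀ η (x y : Icc (0 : ℝ) 1), ‖Φ η x - Φ η y‖ ≤ ‖Φ‖ * |(x : ℝ) - y| := fun η x y =>
    ((Φ η).norm_sub_apply_le x y).trans (mul_le_mul_of_nonneg_right (norm_le_pi_norm Φ η) (abs_nonneg _))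
  have hgM : ∀ x ∈ cfI A, ‖g x‖ ≤ CΓ * ‖Φ‖ := fun x _ => norm_cfVecOf_le Φ (norm_nonneg _) hΦM x
  have hgL : ∀ a ∈ A, ∀ a' ∈ A, ∀ x ∈ cfCyl A a a', ∀ y ∈ cfCyl A a a', ‖g x - g y‖ ≤ CΓ * ‖Φ‖ * |x - y| :=
    fun a ha a' ha' x hx y hy => by
      have := norm_cfVecOf_sub_le Φ (norm_nonneg _) hΦL (cfI_subset_Icc hA (cfCyl_subset_cfI ha ha' hx))
        (cfI_subset_Icc hA (cfCyl_subset_cfI ha ha' hy))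
      rw [← hCΓ] at this; linarith [this]
  have hgℓ : ∀ x ∈ cfI A, ℓ (g x) = 0 := fun x hx => hΦℓ x (cfI_subset_Icc hA hx)
  -- `g = 𝓛 g` on `[0,1]`
  have hfix01 : ∀ x ∈ Icc (0 : ℝ) 1, cfCongL A q s g x = g x := fun x hx => by
    have h := congrArg (fun Ψ => cfVecOf Ψ x) h0
    have e : (1 - cfTwist A hA q s) Φ = Φ - cfTwist A hA q s Φ := rfl
    simp only [e, cfVecOf_sub, cfVecOf_cfTwist A q hA s Φ hx, cfVecOf_zero] at h
    exact (sub_eq_zero.1 h).symm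
  have hzero : ∀ x ∈ cfI A, g x = 0 := fun x hx =>
    eq_zero_of_cfCongL_eq A hA ℓ hβs hβ (by positivity) (by positivity) hgM hgL hgℓ
      (fun y hy => hfix01 y (cfI_subset_Icc hA hy)) hx
  refine eq_of_cfVecOf_eq fun x hx => ?_
  rw [cfVecOf_zero]
  show g x = 0
  rw [← hfix01 x hx, cfCongL_congr A s (G := cfCongL A q s g) (fun a ha a' ha' =>
    (hfix01 _ (cfIA_subset_Icc A (cfMoeb_pair_mem_cfIA ha (hA a ha) (hA a' ha') hx))).symm)]
  exact cfCongL_two_eq_zero_of_eqOn A hA s hzero hx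

end Core

/-! ### Units of `End(Γ_q → CfLip)` -/

section Units

variable {V : Type*} [NormedAddCommGroup V] [NormedSpace ℂ V] [CompleteSpace V]

/-- **A bijective bounded operator on a Banach space is a unit** (open mapping theorem), and
`Ring.inverse` is its set-theoretic inverse. [folklore] -/
theorem isUnit_of_forall_exists (T : V →L[ℂ] V) (hinj : ∀ x, T x = 0 → x = 0) (hsurj : ∀ y, ∃ x, T x = y) :
    IsUnit T ∧ ∀ x, Ring.inverse T (T x) = x := by
  have hker : LinearMap.ker (T : V →ₗ[ℂ] V) = ⊥ := LinearMap.ker_eq_bot'.2 fun x hx => hinj x hx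
  have hrange : LinearMap.range (T : V →ₗ[ℂ] V) = ⊤ := LinearMap.range_eq_top.2 fun y => hsurj y
  set e := ContinuousLinearEquiv.ofBijective T hker hrange with he
  have hunit : IsUnit T := by
    refine ⟨⟨T, (e.symm : V →L[ℂ] V), ?_, ?_⟩, rfl⟩
    · refine ContinuousLinearMap.ext fun y => ?_
      show T (e.symm y) = y
      have : T (e.symm y) = e (e.symm y) := rfl
      rw [this, e.apply_symm_apply]
    · refine ContinuousLinearMap.ext fun y => ?_
      show e.symm (T y) = y
      have : T y = e y := rfl
      rw [this, e.symm_apply_apply]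
  refine ⟨hunit, fun x => ?_⟩
  have h := Ring.inverse_mul_cancel T hunit
  exact congrArg (fun S : V →L[ℂ] V => S x) h

variable (hA : ∀ a ∈ A, 1 ≤ a) {q : ℕ} [NeZero q]
variable {s : ℂ} (hs : 0 ≤ s.re) {θ : ℝ} (hθ : 0 < θ) {β : ℕ → ℝ} (hβ0 : ∀ m, 0 ≤ β m) (hβs : Summable β)

include hs hθ hβ0 hβs in
/-- **`1 - 𝓜_s` is a unit** of `End(Γ_q → CfLip)` as soon as the iterates `𝓛^m_{s,q}` admit summable
(weighted) sup/Lipschitz operator bounds on piecewise Lipschitz functions on `I`; moreover the inverse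
is `cfPreimage` and obeys the sup bound of `cfPreimage_spec`. [cite: MageeOhWinter2019, §3.2 and Thm. 4] -/
theorem isUnit_one_sub_cfTwist_of_bounds
    (hβ : ∀ (m : ℕ) (g : ℝ → CfVec q) (M L : ℝ), 0 ≤ M → 0 ≤ L → (∀ x ∈ cfI A, ‖g x‖ ≤ M) →
      (∀ a ∈ A, ∀ a' ∈ A, ∀ x ∈ cfCyl A a a', ∀ y ∈ cfCyl A a a', ‖g x - g y‖ ≤ L * |x - y|) →
      (∀ x ∈ cfI A, ‖(cfCongL A q s)^[m] g x‖ ≤ β m * (M + θ * L)) ∧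
      (∀ a ∈ A, ∀ a' ∈ A, ∀ x ∈ cfCyl A a a', ∀ y ∈ cfCyl A a a',
        ‖(cfCongL A q s)^[m] g x - (cfCongL A q s)^[m] g y‖ ≤ θ⁻¹ * (β m * (M + θ * L)) * |x - y|)) :
    IsUnit (1 - cfTwist A hA q s) ∧
    ∀ (G : SL(2, ZMod q) → CfLip), Ring.inverse (1 - cfTwist A hA q s) G = cfPreimage A q hA s G := by
  -- the unconstrained case: `ℓ = 0`
  have hβ' : ∀ (m : ℕ) (g : ℝ → CfVec q) (M L : ℝ), 0 ≤ M → 0 ≤ L → (∀ x ∈ cfI A, ‖g x‖ ≤ M) →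
      (∀ a ∈ A, ∀ a' ∈ A, ∀ x ∈ cfCyl A a a', ∀ y ∈ cfCyl A a a', ‖g x - g y‖ ≤ L * |x - y|) →
      (∀ x ∈ cfI A, (0 : CfVec q →L[ℂ] ℂ) (g x) = 0) →
      (∀ x ∈ cfI A, ‖(cfCongL A q s)^[m] g x‖ ≤ β m * (M + θ * L)) ∧
      (∀ a ∈ A, ∀ a' ∈ A, ∀ x ∈ cfCyl A a a', ∀ y ∈ cfCyl A a a',
        ‖(cfCongL A q s)^[m] g x - (cfCongL A q s)^[m] g y‖ ≤ θ⁻¹ * (β m * (M + θ * L)) * |x - y|) :=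
    fun m g M L hM hL h1 h2 _ => hβ m g M L hM hL h1 h2
  have hℓ0 : ∀ (g : SL(2, ZMod q)) (v : CfVec q), (0 : CfVec q →L[ℂ] ℂ) v = 0 → (0 : CfVec q →L[ℂ] ℂ) (cfRep g v) = 0 :=
    fun _ _ _ => rfl
  have hsurj : ∀ G : SL(2, ZMod q) → CfLip, (1 - cfTwist A hA q s) (cfPreimage A q hA s G) = G := fun G =>
    (cfPreimage_spec hA hs hθ hβ0 hβs (0 : CfVec q →L[ℂ] ℂ) hℓ0 hβ' G (norm_nonneg G) (norm_nonneg G)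
      (fun η y => ((G η).norm_apply_le y).trans (norm_le_pi_norm G η))
      (fun η x y => ((G η).norm_sub_apply_le x y).trans (mul_le_mul_of_nonneg_right (norm_le_pi_norm G η) (abs_nonneg _)))
      (fun x _ => rfl)).1
  have hinj : ∀ Φ : SL(2, ZMod q) → CfLip, (1 - cfTwist A hA q s) Φ = 0 → Φ = 0 := fun Φ h0 =>
    eq_zero_of_cfTwist_eq hA hβs (0 : CfVec q →L[ℂ] ℂ) hβ' Φ (fun x _ => rfl) h0
  obtain ⟨hunit, hinv⟩ := isUnit_of_forall_exists _ hinj fun G => ⟨_, hsurj G⟩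
  exact ⟨hunit, fun G => by rw [← hinv (cfPreimage A q hA s G), hsurj G]⟩

end Units

/-! ### The part orthogonal to constants: `1 - B_s`, and the scalar operator at `q = 1` -/

section UnitsB

variable (hA : ∀ a ∈ A, 1 ≤ a) {q : ℕ} [NeZero q]
variable {s : ℂ} (hs : 0 ≤ s.re) {θ : ℝ} (hθ : 0 < θ) {β : ℕ → ℝ} (hβ0 : ∀ m, 0 ≤ β m) (hβs : Summable β)

omit [NeZero q] in
/-- `P₁ G = G - Av G` componentwise. [folklore] -/
theorem cfTwP1_apply' [NeZero q] (G : SL(2, ZMod q) → CfLip) (ξ : SL(2, ZMod q)) :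
    cfTwP1 q G ξ = G ξ - cfTwAv q G := rfl

/-- A family with `Σ_ξ G_ξ = 0` is fixed by `P₁`. [folklore] -/
theorem cfTwP1_eq_self_of_sum_eq_zero {G : SL(2, ZMod q) → CfLip} (hG : ∑ ξ, G ξ = 0) : cfTwP1 q G = G := by
  funext ξ
  rw [cfTwP1_apply', cfTwAv_apply, hG, smul_zero, sub_zero]

/-- `Σ_ξ (P₁ G)_ξ = 0`. [folklore] -/
theorem sum_cfTwP1_apply (G : SL(2, ZMod q) → CfLip) : ∑ ξ, cfTwP1 q G ξ = 0 := by
  simp only [cfTwP1_apply', Finset.sum_sub_distrib, Finset.sum_const, Finset.card_univ, cfTwAv_apply]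
  rw [← smul_assoc, nsmul_eq_mul, mul_inv_cancel₀ (Nat.cast_ne_zero.2 (Fintype.card_ne_zero)), one_smul, sub_self]

/-- If `P₁ Φ = Φ` then `Σ_ξ Φ_ξ = 0`. [folklore] -/
theorem sum_eq_zero_of_cfTwP1_eq {Φ : SL(2, ZMod q) → CfLip} (h : cfTwP1 q Φ = Φ) : ∑ ξ, Φ ξ = 0 := by
  rw [← h]; exact sum_cfTwP1_apply Φ

/-- The constraint `cfSumCoord (vec G) = 0` on `[0,1]` is `Σ_ξ G_ξ = 0`. [folklore] -/
theorem cfSumCoord_cfVecOf_eq_zero {G : SL(2, ZMod q) → CfLip} (hG : ∑ ξ, G ξ = 0) (x : ℝ) :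
    cfSumCoord q (cfVecOf G x) = 0 := by
  rw [cfSumCoord_apply, sum_cfVecOf_apply, hG]; rfl

/-- Conversely, `cfSumCoord (vec Φ) = 0` on `[0,1]` gives `Σ_ξ Φ_ξ = 0`. [folklore] -/
theorem sum_eq_zero_of_cfSumCoord_cfVecOf {Φ : SL(2, ZMod q) → CfLip}
    (h : ∀ x ∈ Icc (0 : ℝ) 1, cfSumCoord q (cfVecOf Φ x) = 0) : ∑ ξ, Φ ξ = 0 := by
  refine CfLip.ext fun x => ?_
  have hx := h x x.2
  rw [cfSumCoord_apply, sum_cfVecOf_apply, CfLip.extend_coe] at hx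
  exact hx

include hs hθ hβ0 hβs in
/-- **`1 - B_s` is a unit** (`B_s = 𝓜_s P₁`, the part of `𝓜_s` orthogonal to constants) as soon as the
iterates `𝓛^m_{s,q}` admit summable (weighted) sup/Lipschitz operator bounds on piecewise Lipschitz
functions on `I` WITH VALUES IN `ℂ^{Γ_q} ⊖ 1`; on families with `Σ_ξ G_ξ = 0` the inverse is `cfPreimage`.
[cite: MageeOhWinter2019, §3.4 and Thm. 4 (1)] -/
theorem isUnit_one_sub_cfTwB_of_bounds
    (hβ : ∀ (m : ℕ) (g : ℝ → CfVec q) (M L : ℝ), 0 ≤ M → 0 ≤ L → (∀ x ∈ cfI A, ‖g x‖ ≤ M) →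
      (∀ a ∈ A, ∀ a' ∈ A, ∀ x ∈ cfCyl A a a', ∀ y ∈ cfCyl A a a', ‖g x - g y‖ ≤ L * |x - y|) →
      (∀ x ∈ cfI A, cfSumCoord q (g x) = 0) →
      (∀ x ∈ cfI A, ‖(cfCongL A q s)^[m] g x‖ ≤ β m * (M + θ * L)) ∧
      (∀ a ∈ A, ∀ a' ∈ A, ∀ x ∈ cfCyl A a a', ∀ y ∈ cfCyl A a a',
        ‖(cfCongL A q s)^[m] g x - (cfCongL A q s)^[m] g y‖ ≤ θ⁻¹ * (β m * (M + θ * L)) * |x - y|)) :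
    IsUnit (1 - cfTwB A hA q s) ∧
    ∀ (G : SL(2, ZMod q) → CfLip), ∑ ξ, G ξ = 0 → Ring.inverse (1 - cfTwB A hA q s) G = cfPreimage A q hA s G := by
  have hℓ : ∀ (g : SL(2, ZMod q)) (v : CfVec q), cfSumCoord q v = 0 → cfSumCoord q (cfRep g v) = 0 :=
    fun g v hv => by rw [cfSumCoord_cfRep, hv]
  set M := cfTwist A hA q s with hM
  set P1 := cfTwP1 q with hP1
  set P0 := cfTwP0 q with hP0
  obtain ⟨h10, h01, h11⟩ := cfTwP1_mul q
  have hT : ∀ Φ, (1 - cfTwB A hA q s) Φ = Φ - M (P1 Φ) := fun Φ => rfl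
  have hP01 : ∀ Φ, P0 (P1 Φ) = 0 := fun Φ => by
    have := congrArg (fun X : (SL(2, ZMod q) → CfLip) →L[ℂ] _ => X Φ) h01; exact this
  have hP10 : ∀ Φ, P1 (P0 Φ) = 0 := fun Φ => by
    have := congrArg (fun X : (SL(2, ZMod q) → CfLip) →L[ℂ] _ => X Φ) h10; exact this
  have hsplit : ∀ Φ, P0 Φ + P1 Φ = Φ := fun Φ => by
    show P0 Φ + (Φ - P0 Φ) = Φ; abel
  have hcomm : ∀ Φ, P0 (M Φ) = M (P0 Φ) := fun Φ => by
    have := congrArg (fun X : (SL(2, ZMod q) → CfLip) →L[ℂ] _ => X Φ) (cfTwP0_comm A hA q s); exact this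
  -- preimages in `V₁`
  have hpre : ∀ G : SL(2, ZMod q) → CfLip, ∑ ξ, G ξ = 0 →
      (1 - M) (cfPreimage A q hA s G) = G ∧ ∑ ξ, cfPreimage A q hA s G ξ = 0 := fun G hG => by
    obtain ⟨h1, h2, -⟩ := cfPreimage_spec hA hs hθ hβ0 hβs (cfSumCoord q) hℓ hβ G (norm_nonneg G) (norm_nonneg G)
      (fun η y => ((G η).norm_apply_le y).trans (norm_le_pi_norm G η))
      (fun η x y => ((G η).norm_sub_apply_le x y).trans (mul_le_mul_of_nonneg_right (norm_le_pi_norm G η) (abs_nonneg _)))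
      (fun x _ => cfSumCoord_cfVecOf_eq_zero hG x)
    exact ⟨h1, sum_eq_zero_of_cfSumCoord_cfVecOf h2⟩
  have hTpre : ∀ G : SL(2, ZMod q) → CfLip, ∑ ξ, G ξ = 0 → (1 - cfTwB A hA q s) (cfPreimage A q hA s G) = G :=
    fun G hG => by
      obtain ⟨h1, h2⟩ := hpre G hG
      have hfix : P1 (cfPreimage A q hA s G) = cfPreimage A q hA s G := cfTwP1_eq_self_of_sum_eq_zero h2
      rw [hT, hfix]
      exact h1
  -- injectivity
  have hinj : ∀ Φ, (1 - cfTwB A hA q s) Φ = 0 → Φ = 0 := fun Φ h0 => by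
    rw [hT, sub_eq_zero] at h0
    have hP0Φ : P0 Φ = 0 := by rw [h0, hcomm, hP01, map_zero]
    have hP1Φ : P1 Φ = Φ := by have := hsplit Φ; rwa [hP0Φ, zero_add] at this
    have hsum : ∑ ξ, Φ ξ = 0 := sum_eq_zero_of_cfTwP1_eq hP1Φ
    have h0' : (1 - M) Φ = 0 := by
      show Φ - M Φ = 0
      rw [sub_eq_zero]; nth_rewrite 1 [h0]; rw [hP1Φ]
    exact eq_zero_of_cfTwist_eq hA hβs (cfSumCoord q) hβ Φ (fun x _ => cfSumCoord_cfVecOf_eq_zero hsum x) h0'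
  -- surjectivity
  have hsurj : ∀ G, ∃ Φ, (1 - cfTwB A hA q s) Φ = G := fun G => by
    refine ⟨P0 G + cfPreimage A q hA s (P1 G), ?_⟩
    have hG1 : ∑ ξ, P1 G ξ = 0 := sum_cfTwP1_apply G
    obtain ⟨h1, h2⟩ := hpre (P1 G) hG1
    have hfix : P1 (cfPreimage A q hA s (P1 G)) = cfPreimage A q hA s (P1 G) := cfTwP1_eq_self_of_sum_eq_zero h2
    rw [hT, map_add, map_add, hP10, map_zero, zero_add, hfix]
    have e : P0 G + cfPreimage A q hA s (P1 G) - M (cfPreimage A q hA s (P1 G)) =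
        P0 G + (1 - M) (cfPreimage A q hA s (P1 G)) := by
      show _ = P0 G + (cfPreimage A q hA s (P1 G) - M (cfPreimage A q hA s (P1 G))); abel
    rw [e, h1, hsplit]
  obtain ⟨hunit, hinv⟩ := isUnit_of_forall_exists _ hinj hsurj
  exact ⟨hunit, fun G hG => by rw [← hinv (cfPreimage A q hA s G), hTpre G hG]⟩

end UnitsB

section Scalar

variable (hA : ∀ a ∈ A, 1 ≤ a)
variable {s : ℂ} (hs : 0 ≤ s.re) {θ : ℝ} (hθ : 0 < θ) {β : ℕ → ℝ} (hβ0 : ∀ m, 0 ≤ β m) (hβs : Summable β)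

/-- `SL₂(ℤ/1ℤ)` has one element. [folklore] -/
instance subsingleton_sl_zmod_one : Subsingleton (SL(2, ZMod 1)) := ⟨fun _ _ => Subtype.ext (Subsingleton.elim _ _)⟩

include hs hθ hβ0 hβs in
/-- **The scalar operator at level `1`:** if the iterates of `𝓛_{s,1}` (the pair operator `L_s²` on
functions `I → ℂ^{Γ_1} = ℂ`) admit summable weighted operator bounds, then `1 - L_s²`, `1 - L_s` and
`1 + L_s` are units of `End(CfLip)`. [cite: MageeOhWinter2019, Thm. 4 (2) at `q = 1`] -/
theorem isUnit_one_sub_cfLOp_of_bounds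
    (hβ : ∀ (m : ℕ) (g : ℝ → CfVec 1) (M L : ℝ), 0 ≤ M → 0 ≤ L → (∀ x ∈ cfI A, ‖g x‖ ≤ M) →
      (∀ a ∈ A, ∀ a' ∈ A, ∀ x ∈ cfCyl A a a', ∀ y ∈ cfCyl A a a', ‖g x - g y‖ ≤ L * |x - y|) →
      (∀ x ∈ cfI A, ‖(cfCongL A 1 s)^[m] g x‖ ≤ β m * (M + θ * L)) ∧
      (∀ a ∈ A, ∀ a' ∈ A, ∀ x ∈ cfCyl A a a', ∀ y ∈ cfCyl A a a',
        ‖(cfCongL A 1 s)^[m] g x - (cfCongL A 1 s)^[m] g y‖ ≤ θ⁻¹ * (β m * (M + θ * L)) * |x - y|)) :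
    IsUnit (1 - cfLOp A hA s ^ 2) ∧ IsUnit (1 - cfLOp A hA s) ∧ IsUnit (1 + cfLOp A hA s) := by
  obtain ⟨hunit, -⟩ := isUnit_one_sub_cfTwist_of_bounds hA (q := 1) hs hθ hβ0 hβs hβ
  set L2 := cfLOp A hA s ^ 2 with hL2
  -- `(1 - 𝓜) (const H) = const ((1 - L²) H)`
  have hconst : ∀ H : CfLip, (1 - cfTwist A hA 1 s) (fun _ => H) = fun _ => (1 - L2) H := fun H => by
    funext ξ
    show H - cfTwist A hA 1 s (fun _ => H) ξ = H - L2 H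
    rw [cfTwist_const]
  have hinvmul : Ring.inverse (1 - cfTwist A hA 1 s) * (1 - cfTwist A hA 1 s) = 1 := Ring.inverse_mul_cancel _ hunit
  have hmulinv : (1 - cfTwist A hA 1 s) * Ring.inverse (1 - cfTwist A hA 1 s) = 1 := Ring.mul_inverse_cancel _ hunit
  have hinj : ∀ H : CfLip, (1 - L2) H = 0 → H = 0 := fun H h0 => by
    have h : (1 - cfTwist A hA 1 s) (fun _ => H) = 0 := by rw [hconst, h0]; rfl
    have h' : (fun _ : SL(2, ZMod 1) => H) = 0 := by
      have := congrArg (fun X : (SL(2, ZMod 1) → CfLip) →L[ℂ] (SL(2, ZMod 1) → CfLip) => X (fun _ => H)) hinvmul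
      change Ring.inverse (1 - cfTwist A hA 1 s) ((1 - cfTwist A hA 1 s) (fun _ => H)) = (fun _ => H) at this
      rw [h, map_zero] at this
      exact this.symm
    exact congrFun h' 1
  have hsurj : ∀ H : CfLip, ∃ G : CfLip, (1 - L2) G = H := fun H => by
    set Ψ := Ring.inverse (1 - cfTwist A hA 1 s) (fun _ => H) with hΨ
    have hΨ1 : (1 - cfTwist A hA 1 s) Ψ = fun _ => H := by
      have := congrArg (fun X : (SL(2, ZMod 1) → CfLip) →L[ℂ] (SL(2, ZMod 1) → CfLip) => X (fun _ => H)) hmulinv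
      exact this
    have hΨc : Ψ = fun _ => Ψ 1 := funext fun ξ => by rw [Subsingleton.elim ξ 1]
    refine ⟨Ψ 1, ?_⟩
    have := congrFun hΨ1 1
    rw [hΨc, hconst] at this
    exact this
  obtain ⟨hL2unit, -⟩ := isUnit_of_forall_exists _ hinj hsurj
  have hfac : 1 - L2 = (1 + cfLOp A hA s) * (1 - cfLOp A hA s) := by
    have := (Commute.one_left (cfLOp A hA s)).sq_sub_sq
    rw [one_pow] at this
    rw [hL2]; exact this
  have hcomm : Commute (1 + cfLOp A hA s) (1 - cfLOp A hA s) :=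
    (Commute.one_right _).sub_right ((Commute.one_left _).add_left (Commute.refl _))
  have hL2' := hL2unit
  rw [hfac] at hL2'
  obtain ⟨hplus, hminus⟩ := hcomm.isUnit_mul_iff.1 hL2'
  exact ⟨hL2unit, hminus, hplus⟩

end Scalar

end Literature.NumberTheory.Sieve
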